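import Summits.QuantumFields.YangMills.Theorems.BalabanUVNodesN15AtSpineCarriersVWordsSite

/-!
# Route «BalabanUVNodes», node N15 = NE2 — ERRATUM CERTIFICATE for the site-kernel faces of seat `pub-ymgap-dag-n15-c` (g5 files S6∕S7∕U5∕R3u):
# the model's `U ≡ 1` site form `Q(G ⊗ 1)²Q*` of the vector single-scale piece has NO right inverse, so the displayed datum `siteForm₀ … ∘ W = 1` is void

Cell `pub-ymgap` (HUMAN RULING D-0062, Track A), seat `pub-ymgap-dag-n15-c` (generation g6; R134 (a) N15 NE2 s1).  Count-neutral; filed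
`--supports` the K3⁗ item (`--as helper`).  Nothing in the tree is edited: the theorems named below stay true — and VACUOUS.

WHAT IS CERTIFIED (kernel-checked, 0 `def`, 0 `sorry`, standard axioms).  The -a vector single-scale piece is `pieceG = reH ∘ covC ∘ (w·reHᵀ)`
(part 15 `…N15VectorPieceEntries`, part 27 `…N15VectorPieceBackground`), and `covC` is the (2.156) unit-lattice covariance of [B6] p.250,
`C^{(k)} = C(C*Δ_kC)⁻¹C*` with `C = elimT` the elimination matrix (`B6Cov2156Torus.bondReductionT_cov`).  By the printed sentence «(CB′)(Γ_{y,x}) = 0,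
x ∈ B(y), y ∈ Λ′, for arbitrary B′» (tree theorem `B6Cov2156Torus.elimT_mulVec_tree`) every ROW of `C` on an axial-tree bond vanishes, hence so does every
row of `C^{(k)}` (§1 `cov_apply_of_isTree`); for `L ≥ 2` the unit bond at the origin in direction `0` IS a tree bond (`isTree_origin`), so
`covC v (0, 0) = 0` for every `v` (`covC_apply_origin`) and the componentwise lift `covC ⊗ 1_ι` is NOT surjective (§2 `not_surjective_tensorId_covC`, `ι`
nonempty).  The `U ≡ 1` site form of the g5 site chain, `siteForm₀ Q (pieceG ⊗ 1) = Q(G ⊗ 1)(G ⊗ 1)Q*` (S2 `SiteLayer.siteForm₀`), is an ENDOMORPHISM of the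
finite-dimensional unit-bond space `(Tor M × Fin (d+1)) × ι → ℝ` that factors as `A ∘ (covC ⊗ 1) ∘ R` with `A` an endomorphism of the same space (§2
`siteForm₀_pieceG_eq_comp`); an endomorphism of that shape has no right inverse (§2 `comp_ne_id_of_not_surjective`: a right inverse makes `A` surjective,
hence injective, hence `covC ⊗ 1` surjective).  CONSEQUENCE (§3): ★ `siteForm₀_pieceG_comp_ne_id` and ★★ **`not_siteDatumW`** — for `L ≥ 2` and `ι`
nonempty the datum `SiteDatumW Ws Ws′ βW δW` of S7 (`…AtSpineCarriersVWordsSite`) holds for NO `Ws, Ws′, βW, δW`.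

WHICH FACES THIS VOIDS (all of this seat's lineage; each keeps the unsatisfiable clause `siteForm₀ … ∘ₗ Ws j = LinearMap.id` among its hypotheses):
S6 `VectorPiece.ne2PlusSite_vectorPiece_vWordsGC` (+ `_dim4`, `…vWordsExpC`, `…vWordsLinC`; p510925), S7 `N15AtSpineCarriers.n15At_vectorPiece_vWordsExpC_site_of_unit`
∕ `…LinC…` and its closers∕guards (p511186), U5 `…n15At_vectorPiece_vWordsExpC_of_U1` ∕ `…LinC_of_U1` + closers (p513483), R3u `…n15At_vectorPiece_vWordsExpC_of_U1rel`
+ closer (p515776, its §3).  NOT affected: S1–S5 (generic site chain over abstract carriers), U1–U4 (the unit datum `unitForm₀ = a·1 − a²Q(G ⊗ 1)Q*` IS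
invertible for small `a ≠ 0`), R1∕R2u∕R2s∕R3s (relative forms `K = K₀ + P` with `K₀` ABSTRACT — the honest repair already in the tree) and R4 (identity-form
certificate).  The g5 caveat (bus l.≈18159) suspected the UNIT side; the void is on the SITE side.  The honest `U ≡ 1` site form is Bałaban's `QG_k²Q*` with the
FULL positive `U ≡ 1` propagator `G_k` ([B6] Prop 2.3 ∕ King (2.14)), not a single piece: a piece's site form is singular.

HONEST FRAMING.  A negative-direction certificate about this lineage's own modelling choice; no printed statement is contradicted ([B9] Thm 3.2 (3.48) inverts
the site form of the FULL propagator).  N15 NOT discharged (0∕1); typed 28∕28 unmoved; one finite T⁴ programme at fixed ε — NOT ℝ⁴, NOT OS, NOT a mass gap,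
NOT Clay.  No decl below carries a cite tag that asserts anything printed beyond the p.250 sentence already certified upstream.
-/

noncomputable section

open Finset

namespace Summit.QuantumFields.YangMills.BalabanUVNodes.N15.VectorPiece

open Literature.MathematicalPhysics.QuantumFieldTheory.Balaban1983to89
open Literature.MathematicalPhysics.QuantumFieldTheory.Balaban1983to89.B5Prop11Plancherel (Tor fine)
open Literature.MathematicalPhysics.QuantumFieldTheory.Balaban1983to89.B6Elimination (corner corner_eq_self_of_dvd)
open Literature.MathematicalPhysics.QuantumFieldTheory.Balaban1983to89.B6BondElimination (IsTree mem_freeB)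
open Literature.MathematicalPhysics.QuantumFieldTheory.Balaban1983to89.B6Lemma24Torus (pbox mem_pbox coarseSites mem_coarseSites)
open Literature.MathematicalPhysics.QuantumFieldTheory.Balaban1983to89.B6LowerBound2153Torus (rep rep_mem_pbox)
open Literature.MathematicalPhysics.QuantumFieldTheory.Balaban1983to89.B6Cov2156Torus (elimT elimT_apply_zero bondReductionT bondReductionT_cov deltaPol)
open Literature.MathematicalPhysics.QuantumFieldTheory.Balaban1983to89.T4EtaRateCoeffDefect (pull)
open Summit.QuantumFields.YangMills.BalabanUVNodes.N15.MatrixSpecies (liftMap)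
open Summit.QuantumFields.YangMills.BalabanUVNodes.N15.SiteLayer (siteForm₀)
open Summit.QuantumFields.YangMills.BalabanUVNodes.N15.BackgroundLayer (fibAvg)
open Summit.QuantumFields.YangMills.Theorems.N15AtSpineCarriers (SiteDatumW)

variable {d : ℕ}

/-! ## §1 The (2.156) covariance has vanishing rows on the axial tree; the origin bond is a tree bond for `L ≥ 2` -/

section Cov

variable {L : ℕ} {M : Fin (d + 1) → ℕ} [∀ μ, NeZero (M μ)]

omit [∀ μ, NeZero (M μ)] in
/-- The rows of the elimination matrix `C` of p.250 vanish on every tree bond (its columns are indexed by the remaining variables, none of which is a tree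
bond). [cite: Balaban1984PropagatorsII, p.250 («(CB′)(Γ_{y,x}) = 0, x ∈ B(y), y ∈ Λ′, for arbitrary B′»)] -/
theorem elimT_apply_of_isTree {p : B4.Idx (pbox M) (d + 1)} (hp : IsTree L (coarseSites L M) p)
    (f : B6Cov2156Torus.freeT L M) : elimT L M p f = 0 := by
  refine elimT_apply_zero (fun h => ?_) (Or.inl hp)
  have hf := (mem_freeB.1 f.2).2
  exact hf (h ▸ hp)

omit [∀ μ, NeZero (M μ)] in
/-- Hence the rows of the (2.156) covariance `C^{(k)} = C(C*Δ_kC)⁻¹C*` vanish on every tree bond, for every quadratic form `Δ`. [cite: Balaban1984PropagatorsII, (2.156) p.250] -/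
theorem cov_apply_of_isTree (Δ : Matrix (B4.Idx (pbox M) (d + 1)) (B4.Idx (pbox M) (d + 1)) ℝ) {p : B4.Idx (pbox M) (d + 1)}
    (hp : IsTree L (coarseSites L M) p) (q : B4.Idx (pbox M) (d + 1)) : (bondReductionT L M Δ).cov p q = 0 := by
  rw [bondReductionT_cov, Matrix.mul_apply]
  refine Finset.sum_eq_zero fun g _ => ?_
  rw [Matrix.mul_apply, Finset.sum_eq_zero fun f _ => by rw [elimT_apply_of_isTree hp f, zero_mul], zero_mul]

omit [∀ μ, NeZero (M μ)] in
/-- The box representative of the torus origin is the origin. [folklore] -/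
theorem rep_zero : rep M (0 : Tor M) = 0 := by
  funext i
  simp [rep]

/-- For `L ≥ 2` the unit bond at the origin in direction `0` is a bond of the axial tree of its block (B5 (1.7): the first bond of `Γ_{0,x}` along the first
coordinate). [cite: Balaban1984PropagatorsI, (1.7) p.18 (the contours Γ_{y,x})] -/
theorem isTree_origin (hL : 2 ≤ L) :
    IsTree L (coarseSites L M) ((⟨rep M (0 : Tor M), rep_mem_pbox M 0⟩, (0 : Fin (d + 1))) : B4.Idx (pbox M) (d + 1)) := by
  have h0 : corner L (0 : Fin (d + 1) → ℤ) = 0 := corner_eq_self_of_dvd _ fun _ => dvd_zero _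
  have hmem : (0 : Fin (d + 1) → ℤ) ∈ pbox M := by
    have h := rep_mem_pbox M (0 : Tor M)
    rwa [rep_zero] at h
  have h1 : (1 : ℤ) < (L : ℤ) := by exact_mod_cast hL
  refine ⟨?_, ?_, fun i hi => absurd hi (Fin.not_lt_zero i)⟩
  · show corner L (rep M (0 : Tor M)) ∈ coarseSites L M
    rw [rep_zero, h0, mem_coarseSites]
    exact ⟨hmem, fun _ => dvd_zero _⟩
  · show rep M (0 : Tor M) 0 + 1 < corner L (rep M (0 : Tor M)) 0 + (L : ℤ)
    rw [rep_zero, h0, Pi.zero_apply, zero_add, zero_add]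
    exact h1

variable (L M)

/-- **The piece's unit-lattice covariance annihilates the origin bond**: `(C^{(k)}v)(0, 0) = 0` for every `v`, every level `n`, every torus, once `L ≥ 2`. [folklore] -/
theorem covC_apply_origin (hL : 2 ≤ L) (n : ℕ) (v : Tor M × Fin (d + 1) → ℝ) : covC L M n v ((0 : Tor M), (0 : Fin (d + 1))) = 0 := by
  simp only [covC, Matrix.mulVecLin_apply, Matrix.mulVec, dotProduct, Matrix.of_apply]
  refine Finset.sum_eq_zero fun b' _ => ?_
  rw [mul_eq_zero]
  exact Or.inl (cov_apply_of_isTree _ (isTree_origin hL) _)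

end Cov

/-! ## §2 The lift `covC ⊗ 1` is not surjective; an endomorphism factoring through it has no right inverse -/

section Lift

variable {X X₂ X₃ : Type} (ι : Type)

/-- The componentwise lift is functorial: `(A ∘ B) ⊗ 1 = (A ⊗ 1) ∘ (B ⊗ 1)`. [folklore] -/
theorem tensorId_comp (A : (X₂ → ℝ) →ₗ[ℝ] (X₃ → ℝ)) (B : (X → ℝ) →ₗ[ℝ] (X₂ → ℝ)) :
    tensorId ι (A ∘ₗ B) = tensorId ι A ∘ₗ tensorId ι B := rfl

variable {ι} {L : ℕ} {M : Fin (d + 1) → ℕ} [∀ μ, NeZero (M μ)]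

/-- **`covC ⊗ 1_ι` is not surjective** (`L ≥ 2`, `ι` nonempty): nothing is mapped onto the indicator of `((0, 0), i)`. [folklore] -/
theorem not_surjective_tensorId_covC [DecidableEq ι] [Nonempty ι] (hL : 2 ≤ L) (n : ℕ) : ¬ Function.Surjective (tensorId ι (covC L M n)) := by
  obtain ⟨i⟩ := ‹Nonempty ι›
  intro h
  obtain ⟨f, hf⟩ := h (fun p => if p = (((0 : Tor M), (0 : Fin (d + 1))), i) then 1 else 0)
  have h1 := congrFun hf (((0 : Tor M), (0 : Fin (d + 1))), i)
  rw [tensorId_apply, covC_apply_origin L M hL n, if_pos rfl] at h1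
  exact zero_ne_one h1

/-- Linear algebra: an endomorphism `A ∘ T ∘ R` of a finite-dimensional space with `A` an endomorphism and `T` NOT surjective has no right inverse
(a right inverse makes `A` surjective, hence injective, hence `T` surjective). [folklore] -/
theorem comp_ne_id_of_not_surjective {V : Type} [AddCommGroup V] [Module ℝ V] [FiniteDimensional ℝ V] (A T R W : V →ₗ[ℝ] V)
    (hT : ¬ Function.Surjective T) : (A ∘ₗ (T ∘ₗ R)) ∘ₗ W ≠ LinearMap.id := by
  intro h
  have hS : Function.Surjective (A ∘ₗ (T ∘ₗ R)) := fun v => ⟨W v, by simpa using LinearMap.congr_fun h v⟩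
  have hA : Function.Surjective A := fun v => by
    obtain ⟨u, hu⟩ := hS v
    exact ⟨T (R u), by simpa using hu⟩
  have hAi : Function.Injective A := LinearMap.injective_iff_surjective.mpr hA
  refine hT fun v => ?_
  obtain ⟨u, hu⟩ := hS (A v)
  have hu' : A (T (R u)) = A v := by simpa using hu
  exact ⟨R u, hAi hu'⟩

variable (ι L M)

/-- The `U ≡ 1` site form of the piece FACTORS through `covC ⊗ 1`: `Q(G ⊗ 1)(G ⊗ 1)Q* = [Q(H ⊗ 1)] ∘ (C^{(k)} ⊗ 1) ∘ [(wHᵀ ⊗ 1)(G ⊗ 1)Q*]`, all three factors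
endomorphisms of ∕ into the unit-bond space. [folklore] -/
theorem siteForm₀_pieceG_eq_comp [Fintype ι] [DecidableEq ι] (n : ℕ) [NeZero n] (kk : ℕ) (w : ℝ) (q : Tor (fine n M) × Fin (d + 1) → Tor M × Fin (d + 1)) :
    siteForm₀ (liftMap q ι) (tensorId ι (pieceG L M n kk w)) =
      (fibAvg (liftMap q ι) ∘ₗ tensorId ι (reH M n)) ∘ₗ (tensorId ι (covC L M (L ^ kk)) ∘ₗ
        (tensorId ι (wTranspose M n w (reH M n)) ∘ₗ (tensorId ι (pieceG L M n kk w) ∘ₗ pull (liftMap q ι)))) := rfl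

/-- ★ **THE SITE DATUM IS VOID**: for `L ≥ 2` and `ι` nonempty, NO operator `W` is a right inverse of the model's `U ≡ 1` site form `Q(G ⊗ 1)²Q*` of the piece —
at any level `n`, any `k`, any weight `w`, any blocking `q` of the fine bonds by unit bonds. [folklore] -/
theorem siteForm₀_pieceG_comp_ne_id [Fintype ι] [DecidableEq ι] [Nonempty ι] (hL : 2 ≤ L) (n : ℕ) [NeZero n] (kk : ℕ) (w : ℝ)
    (q : Tor (fine n M) × Fin (d + 1) → Tor M × Fin (d + 1)) (W : ((Tor M × Fin (d + 1)) × ι → ℝ) →ₗ[ℝ] ((Tor M × Fin (d + 1)) × ι → ℝ)) :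
    siteForm₀ (liftMap q ι) (tensorId ι (pieceG L M n kk w)) ∘ₗ W ≠ LinearMap.id := by
  rw [siteForm₀_pieceG_eq_comp]
  exact comp_ne_id_of_not_surjective _ _ _ _ (not_surjective_tensorId_covC hL _)

end Lift

/-! ## §3 Consequence: `SiteDatumW` is unsatisfiable (S7∕U5∕R3u faces are vacuous-as-typed) -/

section Datum

variable {ι : Type} [Fintype ι] [DecidableEq ι] {L : ℕ} [NeZero L]

/-- ★★ **ERRATUM CERTIFICATE (g6): `¬ SiteDatumW`.**  For `L ≥ 2` and a nonempty Lie-algebra index `ι` the `U ≡ 1` site-kernel datum of S7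
(`…AtSpineCarriersVWordsSite.SiteDatumW`: inverse site kernels of `Q(G ⊗ 1)²Q*` for the -a vector piece) holds for NO data — the piece's site form is
singular (§2).  Hence S7's faces, U5's `…_of_U1` faces and R3u's `…_of_U1rel` face are vacuous; the `_rel` faces (R2s∕R3s, abstract `U ≡ 1` forms) are the
statements of record of this lineage's site layer. [folklore] -/
theorem not_siteDatumW [Nonempty ι] (hL : 2 ≤ L)
    (Ws Ws' : ∀ j : VecIndexS d L, ((Tor j.Mn × Fin (d + 1)) × ι → ℝ) →ₗ[ℝ] ((Tor j.Mn × Fin (d + 1)) × ι → ℝ)) (βW δW : ℝ) :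
    ¬ SiteDatumW (d := d) (ι := ι) (L := L) Ws Ws' βW δW := by
  intro h
  obtain ⟨j⟩ := vecIndexS_nonempty d L
  exact siteForm₀_pieceG_comp_ne_id ι L j.Mn hL (L ^ j.k) j.k (rweight (d := d) L j.k) (qbond L j.k j.Mn) (Ws j) (h.2.2.2.2.1 j)

/-- The same for the FINE half of the datum (King-paired blocking `qbond ∘ kingPrV`, level `L^mL^k`): also void. [folklore] -/
theorem siteForm₀_pieceG_fine_comp_ne_id [Nonempty ι] (hL : 2 ≤ L) (j : VecIndexS d L)
    (W : ((Tor j.Mn × Fin (d + 1)) × ι → ℝ) →ₗ[ℝ] ((Tor j.Mn × Fin (d + 1)) × ι → ℝ)) :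
    siteForm₀ (liftMap (qbond L j.k j.Mn) ι ∘ liftMap (kingPrV L j.k j.m j.Mn) ι)
        (tensorId ι (pieceG L j.Mn (L ^ j.m * L ^ j.k) (j.k + j.m) (rweight (d := d) L j.k / ((L : ℝ) ^ j.m) ^ (d + 1)))) ∘ₗ W ≠
      LinearMap.id :=
  siteForm₀_pieceG_comp_ne_id ι L j.Mn hL (L ^ j.m * L ^ j.k) (j.k + j.m) _ (qbond L j.k j.Mn ∘ kingPrV L j.k j.m j.Mn) W

end Datum

end Summit.QuantumFields.YangMills.BalabanUVNodes.N15.VectorPiece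

end
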